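/-
Origin: expansion seat `planner-pub-hodgecm-mc-axioms-1-g16-0`, handover #6r2 2026-08-20T23:06Z md5 90e182d5306a (NEW; 373 l.; imports as in line 2; ns `HodgeCM.Model.SplitLine` ∕ `HodgeCM.Model`; KERNEL: §1 `abbrev SplitLine.levelW p M := UnitaryGroup.finCongruenceLevel L⁺ L c 1 p.JW (Ideal.span {(M : 𝓞 L)})`, `levelW_le_of_dvd`, `def SplitLine.IsLevelTrivial p χ : Prop := ∃ M ≠ 0, ∀ k ∈ p.levelW M, χ k = 1` (theta-3-g26 (R2) continuity cut; binder-2-g18 K0 RIDER — NO OBJECTION l.14627), `isLevelTrivial_one`, `IsLevelTrivial.mul ∕ .inv`, `isLevelTrivial_iff_exists_ideal : … ↔ ∃ 𝔫 ≠ 0, ∀ k ∈ finCongruenceLevel … 𝔫, χ k = 1`, `isLevelTrivial_iff_isOpen_ker : … ↔ IsOpen (χ.ker : Set U(W)(𝔸_f))`, `def SplitLine.HasRationalRestriction p χ χ₀ : Prop := χ.comp (UnitaryGroup.rationalToFinAdelic L⁺ L c 1 p.JW) = χ₀` (automorphy slot, shape only) + `_iff`, `_one`; §2 `abbrev liuDictionaryOfWeilLine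 … ιV Good GoodChar := liuDictionaryOfWeil … Good GoodChar (SplitLine.PhiMuLine ι₁) SplitLine.typeOfLine` (#4 with #97's K0 pins), `_adm` (Iff.rfl), `_eq_ofTower` (rfl: = `LiuDictionary.ofTower … (fun p => ι₁ ∈ (SignRecipe.lineType p.1.scalar …).1) …`), **`hsmall_of_weilLine_at (hR R c hcite hgood hrec h6 i hJS) : ∃ Γ₀, ∀ Γ ≤ Γ₀, ∃ M k σ', σ'.comp k = c.σ ∧ R.Theta V c i Γ ⊆ U.Uiso Γ M (inflate k (c.Ψ i)) σ'`** (:= binder-2 #95 `hsmall_of_tower_at_of_scalar` at `Char := {p ∕∕ Good p}`, `Adm p := {χ ∕∕ GoodChar p.1 χ}`, `Ω p a := p.1.Ω ιV a.1`, `scalar p := p.1.scalar`); §3 (binder-2 K0 RIDER 2 l.14634, the INDEXED form) `abbrev liuDictionaryOfWeilFamily … ιV (I : Type) (line : I → SplitLine …) (GoodChar : (i : I) → (line i).CharW → Prop) := LiuDictionary.ofTower … I (fun i => {χ ∕∕ GoodChar i χ}) (fun i a => (line i).Ω ιV a.1) (fun i => PhiMuLine ι₁ (line i)) (fun i dd =>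 dd.IsReflexOfTypeG ι₁ (typeOfLine (line i)))`, `_H ∕ _Ω ∕ _adm` (rfl), `liuDictionaryOfWeilLine_eq_family` (rfl: subtype form = family form at `line := Subtype.val`), **`hsmall_of_weilFamily_at`** (#95 at `Char := I`, `scalar i := (line i).scalar`); §4 (theta-3-g26 THE WORD l.14646 `χ₀ := 1`) **`def SplitLine.IsAutChar p χ : Prop := p.IsLevelTrivial χ ∧ p.HasRationalRestriction χ 1`** (the `GoodChar` OF RECORD: [Liu21] Def. 4.11 third bullet, a character of `E¹\\(𝔸_E^∞)¹` — continuity ∧ triviality on the rational points, no archimedean component; definitional predicate, nothing asserted) + `isAutChar_iff` (↔ `IsOpen ker ∧ ∀ γ, χ (rationalToFinAdelic γ) = 1`), `isAutChar_one`, `IsAutChar.mul ∕ .inv`, `abbrev liuDictionaryOfWeilFamilyAut … ιV I line := liuDictionaryOfWeilFamily … I line (fun i χ => (line i).IsAutChar χ)` + `_eq` (rfl) + **`hsmall_of_weilFamilyAut_at`** (§3 at `GoodChar := IsAutChar`; parameters left: the theta lane's `I` and `line : I → SplitLine …`). CERT lean-direct (1 process, nice 19, elan 4.32.0, `-DautoImplicit=false`)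 over the GO #2₆₅ PKG oleans (symlink overlay `farm/mkolib65.sh`, nothing written in PKG): rc 0 ∕ 16 s ∕ 0 warn ∕ 0 proof holes `farm/logs/j3lvl-5.log`; `#print axioms` 30 ∕ 30 ⊆ {propext, Classical.choice, Quot.sound}, `proof-holeAx` 0 `farm/logs/j3lvl-axioms.log` 37050698ada3; placeholder-token grep 0; source `lean/J3lvl/src/`; NAME LIST (theorems): `HodgeCM.Model.SplitLine.isLevelTrivial_iff_isOpen_ker` · `HodgeCM.Model.hsmall_of_weilLine_at` · `HodgeCM.Model.hsmall_of_weilFamilyAut_at`) (`HOME/mc/pub-hodgecm-mc-axioms-1-g16/stage66/HodgeCM/Model/LiuDictionaryInstanceLevel.lean`, md5 90e182d5306a, 373 lines);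
landed by the second packager p2 gen 15 (p2-g15) in gate run 66 as `HodgeCM/Model/LiuDictionaryInstanceLevel.lean` (verbatim).
-/
/-
unit pub-hodgecm-mc-axioms-1-g16 (gen 16), seat planner-pub-hodgecm-mc-axioms-1-g16-0, 2026-08-20.
(J3) THE CHARACTER CUT OF THE ADÈLIC INDEX — the CONTINUITY term `SplitLine.IsLevelTrivial` for the `GoodChar` parameter of
`liuDictionaryOfWeil` (theta-3-g26 WEIL-CUSTODY ANSWER (R2), binder-2-g18 K0 RIDER), the AUTOMORPHY slot `HasRationalRestriction`
(pinned `χ₀ := 1` by theta-3-g26 THE WORD: `SplitLine.IsAutChar`), and binder-2-g18's pointwise `hsmall` socket #95 read over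
the (J3) instance with the K0 pins of #97.
KERNEL definitions and theorems only: no `def … : Prop` record of a published sentence, nothing cited; E / row 9 / MODEL-N untouched.
-/
import Summits.HodgeConjecture.HodgeCM.Model.LiuDictionaryInstance
import Summits.HodgeConjecture.HodgeCM.Model.Binders.JLiuHermLineType
import Summits.HodgeConjecture.HodgeCM.Model.HsmallOfTowerAtLineType
import Literature.NumberTheory.Automorphic.UnitaryGroupCongruenceSubgroupLevels

set_option autoImplicit false

/-!
# (J3) The character cut of the Weil-coinvariant dictionary, and E's `hsmall` over the instance

axioms-1 #4 `liuDictionaryOfWeil … ιV Good GoodChar PhiMu typeOf` (RUN 64 ∕ r3 RUN 65) indexes the carriers by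
`Σ p : {p : SplitLine … // Good p}, {χ : p.CharW // GoodChar p χ}` with `p.CharW = (U(W)(𝔸_f) →* ℂˣ)` a BARE hom.
theta-3-g26 (WEIL-CUSTODY ANSWER, STATUS 2026-08-20T22:19:43Z (R2)): for a `χ` non-trivial on every open subgroup the
coinvariants `Ω(p, χ)` vanish, so the cited sentences over the instance are false unless `GoodChar p χ` contains
«`χ = 1` on `U(W)(𝔸_f) ∩ K(𝔫)` for some level `𝔫`»; and at `n = 3` no finite-place `ε`-condition occurs ([Liu21] App. D
Lem. D.1 (1) is void for an isotropic rank-3 space).  This leaf supplies the TERMS and the E-facing socket: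

* `SplitLine.levelW p M := U(W)(𝔸_f) ∩ K_f(M)` (PKG `UnitaryGroup.finCongruenceLevel … 1 p.JW (M)`, the level currency of
  `Model/ArchKTypeOfFin`), `SplitLine.IsLevelTrivial p χ := ∃ M ≠ 0, χ = 1 on levelW p M`; `isLevelTrivial_one`, closure under
  products, and the two characterisations `isLevelTrivial_iff_exists_ideal` (theta-3's wording: some ideal level `𝔫 ≠ 0`) and
  `isLevelTrivial_iff_isOpen_ker` (`χ` is smooth: its kernel is open — PKG `exists_finCongruenceLevel_span_le_of_isOpen`);
* `SplitLine.HasRationalRestriction p χ χ₀ := χ ∘ (U(W)(L⁺) → U(W)(𝔸_f)) = χ₀` — the SHAPE of the automorphy clause (the finite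
  part of an automorphic character of `U(W) = E¹` with archimedean part `χ_∞` restricts to `χ_∞⁻¹` on the rational points); the
  datum `χ₀` is the theta lane's to pin (weight one, [Liu21] Def. 4.12) and nothing about it is asserted here;
* `liuDictionaryOfWeilLine … ιV Good GoodChar` := #4 with binder-2-g18's K0 pins `PhiMu := SplitLine.PhiMuLine ι₁`,
  `typeOf := SplitLine.typeOfLine` (#97; theta-3 K0 WORD 2026-08-20T22:07:03Z), `Good` ∕ `GoodChar` still parameters;
* `hsmall_of_weilLine_at` — binder-2-g18 #95 `hsmall_of_tower_at_of_scalar` at `Char := {p // Good p}`,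
  `Adm p := {χ // GoodChar p.1 χ}`, `Ω p a := Ω(p, a)`, `scalar p := a_p`: from the five cited sentences for
  `liuDictionaryOfWeilLine`, the good context (theta-model and recipe form), E's scope conjunction and a finite set of good index
  lines of scalar `a_i` carrying the (J4) families, the `hsmall` clause of E at `(V, c, i)` — by `rfl` on #97 `HermLineDatum.lineType`.
* `liuDictionaryOfWeilFamily … ιV I line GoodChar` + `hsmall_of_weilFamily_at` — the INDEXED form (`Char := I`, the theta lane's
  own parameter type, through `line : I → SplitLine …`), which is the shape binder-2-g18's K0 RIDER 2 asks for (the cited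
  `MuSeparated` ∕ `Prop413` need the index to enumerate Liu's pairs exactly once); the subtype form is its case `line := Subtype.val`.
* `SplitLine.IsAutChar p χ := IsLevelTrivial p χ ∧ HasRationalRestriction p χ 1` — the `GoodChar` OF RECORD (theta-3-g26 THE WORD
  2026-08-20T23:03:59Z: `χ₀ := 1`; [Liu21] Def. 4.11 third bullet «automorphic character `χ : E¹\(𝔸_E^∞)¹ → ℂ^×`» has no
  archimedean component), `isAutChar_iff` ∕ `_one` ∕ `.mul` ∕ `.inv`; `liuDictionaryOfWeilFamilyAut … ιV I line` (the indexed
  dictionary at `GoodChar := IsAutChar`) + `hsmall_of_weilFamilyAut_at`.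
KERNEL: definitions + theorems; 0 records, 0 cited sentences; expected `#print axioms` ⊆ {propext, Classical.choice, Quot.sound}.
-/

noncomputable section

open Function Set
open NumberField
open Literature.AlgebraicGeometry.Motives
open Literature.AlgebraicGeometry.ShimuraVarieties
open Literature.AlgebraicGeometry.HodgeTheory
open Literature.NumberTheory.Automorphic
open Literature.NumberTheory.Automorphic.PicardCM
open Literature.NumberTheory.Transcendental (Arapura2012_Cor_15_4_6)

namespace HodgeCM.Model

open HodgeCM.Model.TowerLevel HodgeCM.Model.TowerCarrier HodgeCM.Literature.Theta HodgeCM.Literature.Theta.LiuAlbaneseModuleDatum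
open HodgeCM.CMTypeOps (inflate)
open HodgeCM.Universe (ThetaModel)

/-! ## 1. The continuity cut `IsLevelTrivial` and the automorphy slot -/

namespace SplitLine

variable {L : CMField} {ι₁ : (L : Type) →+* ℂ} {V : HermSpace3 L ι₁}
  {JV : Matrix (Fin 3) (Fin 3) (L : Type)} {TV : Matrix (Fin 3) (Fin 3) ↥(maximalRealSubfield (L : Type))}
  {δ : (L : Type)} {hcδ : IsCMField.complexConj (L : Type) δ = -δ} {hδ : δ ≠ 0} {d : ↥(maximalRealSubfield (L : Type))}
  {hd : δ * δ = algebraMap _ (L : Type) d} {hV : TV.IsSymm} {hVd : IsUnit TV.det}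
  {hJV : JV = TV.map (algebraMap _ (L : Type))}
  (p : SplitLine JV TV hcδ hδ hd hV hVd hJV)

/-- **`U(W)(𝔸_f) ∩ K_f(M)`** — the principal finite congruence level of the line of `p` at the INTEGER level `M`
(PKG `UnitaryGroup.finCongruenceLevel` at the ideal `M𝓞_L`). [folklore] -/
abbrev levelW (M : ℕ) :
    Subgroup ↥(UnitaryGroup.finAdelic (↥(maximalRealSubfield (L : Type))) (L : Type) (IsCMField.complexConj (L : Type)) 1 p.JW) :=
  UnitaryGroup.finCongruenceLevel (↥(maximalRealSubfield (L : Type))) (L : Type) (IsCMField.complexConj (L : Type)) 1 p.JW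
    (Ideal.span {(M : 𝓞 L)})

/-- (Ported verbatim from the HodgeCMPerL package; no docstring in the source.) -/
theorem span_natCast_ne_zero' {M : ℕ} (hM : M ≠ 0) : (Ideal.span {(M : 𝓞 L)} : Ideal (𝓞 L)) ≠ 0 := by
  rw [Ne, Ideal.zero_eq_bot, Ideal.span_singleton_eq_bot]
  exact_mod_cast hM

/-- the levels decrease along divisibility: `M ∣ M' ≠ 0 → K_f(M') ≤ K_f(M)`. [folklore] -/
theorem levelW_le_of_dvd {M M' : ℕ} (hM' : M' ≠ 0) (h : M ∣ M') : p.levelW M' ≤ p.levelW M :=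
  UnitaryGroup.finCongruenceLevel_mono (span_natCast_ne_zero' hM')
    (Ideal.span_singleton_le_span_singleton.2 (Nat.cast_dvd_cast h))

/-- **`χ` is LEVEL-TRIVIAL** (continuous ∕ smooth): `χ = 1` on `U(W)(𝔸_f) ∩ K_f(M)` for some integer level `M ≠ 0` —
theta-3-g26's NECESSARY clause of `GoodChar` (else `Ω(p, χ) = 0`). A definitional predicate on the bare hom, not a record.
[folklore] -/
def IsLevelTrivial (χ : p.CharW) : Prop := ∃ M : ℕ, M ≠ 0 ∧ ∀ k ∈ p.levelW M, χ k = 1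

/-- the trivial character is level-trivial (level `1`). -/
theorem isLevelTrivial_one : p.IsLevelTrivial 1 := ⟨1, one_ne_zero, fun _ _ => rfl⟩

/-- level-trivial characters are closed under products (level `M M'`). -/
theorem IsLevelTrivial.mul {χ χ' : p.CharW} (hχ : p.IsLevelTrivial χ) (hχ' : p.IsLevelTrivial χ') :
    p.IsLevelTrivial (χ * χ') := by
  obtain ⟨M, hM, h⟩ := hχ
  obtain ⟨M', hM', h'⟩ := hχ'
  refine ⟨M * M', mul_ne_zero hM hM', fun k hk => ?_⟩
  rw [MonoidHom.mul_apply, h k (p.levelW_le_of_dvd (mul_ne_zero hM hM') (dvd_mul_right M M') hk),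
    h' k (p.levelW_le_of_dvd (mul_ne_zero hM hM') (dvd_mul_left M' M) hk), one_mul]

/-- level-trivial characters are closed under inverses (same level). -/
theorem IsLevelTrivial.inv {χ : p.CharW} (hχ : p.IsLevelTrivial χ) : p.IsLevelTrivial χ⁻¹ := by
  obtain ⟨M, hM, h⟩ := hχ
  exact ⟨M, hM, fun k hk => by rw [MonoidHom.inv_apply, h k hk, inv_one]⟩

/-- **theta-3's wording**: `χ` is level-trivial iff `χ = 1` on `U(W)(𝔸_f) ∩ K_f(𝔫)` for some IDEAL level `𝔫 ≠ 0`
(every ideal level contains the integer level `N(𝔫)`, PKG `finCongruenceLevel_span_absNorm_le`). [folklore] -/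
theorem isLevelTrivial_iff_exists_ideal (χ : p.CharW) :
    p.IsLevelTrivial χ ↔ ∃ 𝔫 : Ideal (𝓞 L), 𝔫 ≠ 0 ∧
      ∀ k ∈ UnitaryGroup.finCongruenceLevel (↥(maximalRealSubfield (L : Type))) (L : Type)
        (IsCMField.complexConj (L : Type)) 1 p.JW 𝔫, χ k = 1 := by
  constructor
  · rintro ⟨M, hM, h⟩
    exact ⟨Ideal.span {(M : 𝓞 L)}, span_natCast_ne_zero' hM, h⟩
  · rintro ⟨𝔫, h𝔫, h⟩
    refine ⟨Ideal.absNorm 𝔫, Ideal.absNorm_eq_zero_iff.not.2 (by rwa [← Ideal.zero_eq_bot]), fun k hk => h k ?_⟩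
    exact UnitaryGroup.finCongruenceLevel_span_absNorm_le h𝔫 hk

/-- **level-trivial = smooth**: `χ` is level-trivial iff its kernel is OPEN in `U(W)(𝔸_f)` (the principal levels are open,
PKG `isOpen_finCongruenceLevel`, and every open subgroup contains one, PKG `exists_finCongruenceLevel_span_le_of_isOpen`).
[folklore] -/
theorem isLevelTrivial_iff_isOpen_ker (χ : p.CharW) :
    p.IsLevelTrivial χ ↔
      IsOpen ((χ.ker : Subgroup _) : Set ↥(UnitaryGroup.finAdelic (↥(maximalRealSubfield (L : Type))) (L : Type)
        (IsCMField.complexConj (L : Type)) 1 p.JW)) := by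
  constructor
  · rintro ⟨M, hM, h⟩
    exact Subgroup.isOpen_mono (fun k hk => (MonoidHom.mem_ker).2 (h k hk))
      (UnitaryGroup.isOpen_finCongruenceLevel _ _ _ _ _ (span_natCast_ne_zero' hM))
  · intro hχ
    obtain ⟨M, hM, hle⟩ := UnitaryGroup.exists_finCongruenceLevel_span_le_of_isOpen hχ
    exact ⟨M, hM, fun k hk => (MonoidHom.mem_ker).1 (hle hk)⟩

/-- **the automorphy slot (SHAPE only)**: `χ` HAS RATIONAL RESTRICTION `χ₀` if its pullback along the diagonal
`U(W)(L⁺) → U(W)(𝔸_f)` (PKG `UnitaryGroup.rationalToFinAdelic`) is `χ₀` — the finite part of an automorphic character of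
`U(W)(L⁺)\U(W)(𝔸)` with archimedean part `χ_∞` has rational restriction `χ_∞⁻¹|_{U(W)(L⁺)}`.  The datum `χ₀` of an index
line is the theta lane's (weight one); a definitional predicate, nothing asserted. [folklore] -/
def HasRationalRestriction (χ : p.CharW)
    (χ₀ : ↥(UnitaryGroup.rational (↥(maximalRealSubfield (L : Type))) (L : Type) (IsCMField.complexConj (L : Type)) 1 p.JW) →*
      ℂˣ) : Prop :=
  χ.comp (UnitaryGroup.rationalToFinAdelic (↥(maximalRealSubfield (L : Type))) (L : Type) (IsCMField.complexConj (L : Type))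
    1 p.JW) = χ₀

/-- (Ported verbatim from the HodgeCMPerL package; no docstring in the source.) -/
theorem hasRationalRestriction_iff (χ : p.CharW)
    (χ₀ : ↥(UnitaryGroup.rational (↥(maximalRealSubfield (L : Type))) (L : Type) (IsCMField.complexConj (L : Type)) 1 p.JW) →*
      ℂˣ) :
    p.HasRationalRestriction χ χ₀ ↔
      ∀ γ, χ (UnitaryGroup.rationalToFinAdelic (↥(maximalRealSubfield (L : Type))) (L : Type)
        (IsCMField.complexConj (L : Type)) 1 p.JW γ) = χ₀ γ :=
  ⟨fun h γ => by rw [← h, MonoidHom.comp_apply], fun h => MonoidHom.ext h⟩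

/-- (Ported verbatim from the HodgeCMPerL package; no docstring in the source.) -/
theorem hasRationalRestriction_one : p.HasRationalRestriction 1 1 := MonoidHom.ext fun _ => rfl

end SplitLine

/-! ## 2. The dictionary with the K0 pins, and E's `hsmall` over it -/

variable (hHD : exists_isReal_hodgeModel) (hI : hodgePQ_independent_of_hodgeModel)
  (h₁ : BallQuotientUniformised) (h₃ : CMAbelianVarietyRealised) (hA : Arapura2012_Cor_15_4_6)
variable {L : CMField} {ι₁ : (L : Type) →+* ℂ} (V : HermSpace3 L ι₁)
variable (JV : Matrix (Fin 3) (Fin 3) (L : Type)) (TV : Matrix (Fin 3) (Fin 3) ↥(maximalRealSubfield (L : Type)))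
  {δ : (L : Type)} (hcδ : IsCMField.complexConj (L : Type) δ = -δ) (hδ : δ ≠ 0) {d : ↥(maximalRealSubfield (L : Type))}
  (hd : δ * δ = algebraMap _ (L : Type) d) (hV : TV.IsSymm) (hVd : IsUnit TV.det)
  (hJV : JV = TV.map (algebraMap _ (L : Type)))
  (ιV : ↥V.adelicFin →*
    ↥(UnitaryGroup.finAdelic (↥(maximalRealSubfield (L : Type))) (L : Type) (IsCMField.complexConj (L : Type)) 3 JV))
  (Good : SplitLine JV TV hcδ hδ hd hV hVd hJV → Prop)
  (GoodChar : (p : SplitLine JV TV hcδ hδ hd hV hVd hJV) → p.CharW → Prop)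

/-- **(J3) with the K0 pins**: `liuDictionaryOfWeil` (#4) with `PhiMu := SplitLine.PhiMuLine ι₁` («`ι₁ ∈ Φ^δ(a_p)`») and
`typeOf := SplitLine.typeOfLine` (`Φ^δ(a_p)`) — binder-2-g18 #97 on theta-3-g26's K0 word; the cuts `Good` (weight one,
admissible line) and `GoodChar` (⊇ `IsLevelTrivial`, + the automorphy clause) remain parameters. [folklore] -/
abbrev liuDictionaryOfWeilLine : LiuDictionary hHD hI h₁ h₃ V :=
  liuDictionaryOfWeil hHD hI h₁ h₃ hA V JV TV hcδ hδ hd hV hVd hJV ιV Good GoodChar (SplitLine.PhiMuLine ι₁)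
    SplitLine.typeOfLine

/-- (Ported verbatim from the HodgeCMPerL package; no docstring in the source.) -/
theorem liuDictionaryOfWeilLine_adm (p : {p : SplitLine JV TV hcδ hδ hd hV hVd hJV // Good p}) (dd : LiuCMSide) :
    (liuDictionaryOfWeilLine hHD hI h₁ h₃ hA V JV TV hcδ hδ hd hV hVd hJV ιV Good GoodChar).adm p dd ↔
      dd.IsReflexOfTypeG ι₁ p.1.lineType := Iff.rfl

/-- (Ported verbatim from the HodgeCMPerL package; no docstring in the source.) -/
theorem liuDictionaryOfWeilLine_eq_ofTower :
    liuDictionaryOfWeilLine hHD hI h₁ h₃ hA V JV TV hcδ hδ hd hV hVd hJV ιV Good GoodChar =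
      LiuDictionary.ofTower hHD hI h₁ h₃ hA V {p : SplitLine JV TV hcδ hδ hd hV hVd hJV // Good p}
        (fun p => {χ : p.1.CharW // GoodChar p.1 χ}) (fun p a => p.1.Ω ιV a.1)
        (fun p => ι₁ ∈ (SignRecipe.lineType p.1.scalar p.1.conj_scalar p.1.scalar_ne_zero).1)
        (fun p dd => dd.IsReflexOfTypeG ι₁ (SignRecipe.lineType p.1.scalar p.1.conj_scalar p.1.scalar_ne_zero)) := rfl

/-- **E's `hsmall` OVER THE (J3) INSTANCE, POINTWISE** (binder-2-g18 #95 `hsmall_of_tower_at_of_scalar` at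
`Char := {p // Good p}`, `Adm p := {χ // GoodChar p χ}`, `Ω p a := Ω(p, a)` through `ιV`, `scalar p := a_p`): one theta model
`R`, one `(L, ι₁, V, c, i)`; the five cited sentences for `liuDictionaryOfWeilLine`; the theta model's good context and the
recipe-form good context of the bit of record; E's scope conjunction; a finite set `S` of good index lines of scalar `a_i`
carrying the (J4) families of component classes — then the `hsmall` clause of E at that point. Nothing is cited HERE: the
sentences are the hypothesis `hcite`. -/
theorem hsmall_of_weilLine_at (hR : DeligneMilne1982_Thm_6_20_full)
    (R : (picardCMUniverse hHD hI h₁ h₃).ThetaModel) (c : SeesawCtx L)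
    (hcite : (liuDictionaryOfWeilLine hHD hI h₁ h₃ hA V JV TV hcδ hδ hd hV hVd hJV ιV Good GoodChar).Irreducible ∧
      (liuDictionaryOfWeilLine hHD hI h₁ h₃ hA V JV TV hcδ hδ hd hV hVd hJV ιV Good GoodChar).Prop413 ∧
      (liuDictionaryOfWeilLine hHD hI h₁ h₃ hA V JV TV hcδ hδ hd hV hVd hJV ιV Good GoodChar).Thm418_2 ∧
      (liuDictionaryOfWeilLine hHD hI h₁ h₃ hA V JV TV hcδ hδ hd hV hVd hJV ιV Good GoodChar).MuSeparated ∧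
      (liuDictionaryOfWeilLine hHD hI h₁ h₃ hA V JV TV hcδ hδ hd hV hVd hJV ιV Good GoodChar).Thm418C)
    (hgood : R.GoodCtx ι₁ c) (hrec : SignRecipe.GoodCtx (Model.orientBitι L ι₁) ι₁ c)
    (h6 : Module.finrank ℚ c.K = 6 ∧ IsNormalClosure ℚ c.K L ∧ (Module.finrank ℚ L = 24 ∨ Module.finrank ℚ L = 48))
    (i : Fin 4)
    (hJS : ∃ S : Finset {p : SplitLine JV TV hcδ hδ hd hV hVd hJV // Good p},
        (∀ p ∈ S, p.1.scalar = c.D.a i) ∧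
        ∀ (Γ : Level V) (hΓ : Γ.BelowConjThree), ∀ ω ∈ R.Theta V c i Γ,
          ∃ cf : towerLevel hHD hI (ballQuotientUniformisedDatum_of h₁) h₃ hA Γ hΓ,
            TowerLevel.res hHD hI (ballQuotientUniformisedDatum_of h₁) h₃ hA cf = ω ∧
              (ofLevel hHD hI (ballQuotientUniformisedDatum_of h₁) h₃ hA Γ hΓ cf :
                  (liuDictionaryOfWeilLine hHD hI h₁ h₃ hA V JV TV hcδ hδ hd hV hVd hJV ιV Good GoodChar).H) ∈
                ⨆ p ∈ S, (liuDictionaryOfWeilLine hHD hI h₁ h₃ hA V JV TV hcδ hδ hd hV hVd hJV ιV Good GoodChar).block p) :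
    ∃ Γ₀ : Level V, ∀ Γ ≤ Γ₀,
      ∃ (M : CMField) (k : c.K →+* M) (σ' : M →+* ℂ), σ'.comp k = c.σ ∧
        R.Theta V c i Γ ⊆ (picardCMUniverse hHD hI h₁ h₃).Uiso Γ M (inflate k (c.Ψ i)) σ' :=
  hsmall_of_tower_at_of_scalar hHD hI h₁ h₃ hR hA R V c {p : SplitLine JV TV hcδ hδ hd hV hVd hJV // Good p}
    (fun p => {χ : p.1.CharW // GoodChar p.1 χ}) (fun p a => p.1.Ω ιV a.1) (fun p => p.1.scalar)
    (fun p => p.1.conj_scalar) (fun p => p.1.scalar_ne_zero) hcite hgood hrec h6 i hJS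

/-! ## 3. The INDEXED form: the theta lane's own parameter type as `Char` (binder-2-g18 K0 RIDER 2)

The cited `MuSeparated` ∕ `Prop413` compare and sum over the INDEX, so the index must ENUMERATE Liu's pairs `(μ, ε)` exactly
once (binder-2-g18 K0 RIDER 2, STATUS 2026-08-20T22:56:39Z): as `SplitLine` records carry data (`n`, `e`, a Gram representative,
a splitting) with many representatives per pair, the faithful shape lets the theta lane index by ITS parameter type `I` through
a map `line : I → SplitLine …` — `MuSeparated` then reads `i = i'` in `I`.  The subtype form is the case `I := {p // Good p}`,
`line := Subtype.val` (`liuDictionaryOfWeilLine_eq_family`, `rfl`). -/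

variable {JV TV hcδ hδ hd hV hVd hJV}

/-- **(J3) INDEXED**: `LiuDictionary.ofTower` with `Char := I`, `Adm i := {χ : (line i).CharW // GoodChar i χ}`,
`Ω i a := Ω(line i, a)` through `ιV`, and the K0 pins `PhiMu i := ι₁ ∈ Φ^δ(a_{line i})`, `adm i := IsReflexOfTypeG ι₁ Φ^δ(a_{line i})`.
The enumeration `I`, `line` and the cut `GoodChar` are the theta lane's parameters. [folklore] -/
abbrev liuDictionaryOfWeilFamily (I : Type) (line : I → SplitLine JV TV hcδ hδ hd hV hVd hJV)
    (GoodCharI : (i : I) → (line i).CharW → Prop) : LiuDictionary hHD hI h₁ h₃ V :=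
  LiuDictionary.ofTower hHD hI h₁ h₃ hA V I (fun i => {χ : (line i).CharW // GoodCharI i χ})
    (fun i a => (line i).Ω ιV a.1) (fun i => SplitLine.PhiMuLine ι₁ (line i))
    (fun i dd => dd.IsReflexOfTypeG ι₁ (SplitLine.typeOfLine (line i)))

variable (I : Type) (line : I → SplitLine JV TV hcδ hδ hd hV hVd hJV) (GoodCharI : (i : I) → (line i).CharW → Prop)

/-- (Ported verbatim from the HodgeCMPerL package; no docstring in the source.) -/
theorem liuDictionaryOfWeilFamily_H :
    (liuDictionaryOfWeilFamily hHD hI h₁ h₃ hA V ιV I line GoodCharI).H =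
      Tower hHD hI (ballQuotientUniformisedDatum_of h₁) h₃ hA V := rfl

/-- (Ported verbatim from the HodgeCMPerL package; no docstring in the source.) -/
theorem liuDictionaryOfWeilFamily_Ω (i : I) (a : {χ : (line i).CharW // GoodCharI i χ}) :
    (liuDictionaryOfWeilFamily hHD hI h₁ h₃ hA V ιV I line GoodCharI).Ω i a = (line i).Ω ιV a.1 := rfl

/-- (Ported verbatim from the HodgeCMPerL package; no docstring in the source.) -/
theorem liuDictionaryOfWeilFamily_adm (i : I) (dd : LiuCMSide) :
    (liuDictionaryOfWeilFamily hHD hI h₁ h₃ hA V ιV I line GoodCharI).adm i dd ↔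
      dd.IsReflexOfTypeG ι₁ (line i).lineType := Iff.rfl

/-- the subtype form (§2) is the indexed form at `I := {p // Good p}`, `line := Subtype.val`. -/
theorem liuDictionaryOfWeilLine_eq_family :
    liuDictionaryOfWeilLine hHD hI h₁ h₃ hA V JV TV hcδ hδ hd hV hVd hJV ιV Good GoodChar =
      liuDictionaryOfWeilFamily hHD hI h₁ h₃ hA V ιV {p : SplitLine JV TV hcδ hδ hd hV hVd hJV // Good p} Subtype.val
        (fun p χ => GoodChar p.1 χ) := rfl

/-- **E's `hsmall` OVER THE INDEXED INSTANCE, POINTWISE** (binder-2-g18 #95 at `Char := I`, `scalar i := a_{line i}`). -/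
theorem hsmall_of_weilFamily_at (hR : DeligneMilne1982_Thm_6_20_full)
    (R : (picardCMUniverse hHD hI h₁ h₃).ThetaModel) (c : SeesawCtx L)
    (hcite : (liuDictionaryOfWeilFamily hHD hI h₁ h₃ hA V ιV I line GoodCharI).Irreducible ∧
      (liuDictionaryOfWeilFamily hHD hI h₁ h₃ hA V ιV I line GoodCharI).Prop413 ∧
      (liuDictionaryOfWeilFamily hHD hI h₁ h₃ hA V ιV I line GoodCharI).Thm418_2 ∧
      (liuDictionaryOfWeilFamily hHD hI h₁ h₃ hA V ιV I line GoodCharI).MuSeparated ∧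
      (liuDictionaryOfWeilFamily hHD hI h₁ h₃ hA V ιV I line GoodCharI).Thm418C)
    (hgood : R.GoodCtx ι₁ c) (hrec : SignRecipe.GoodCtx (Model.orientBitι L ι₁) ι₁ c)
    (h6 : Module.finrank ℚ c.K = 6 ∧ IsNormalClosure ℚ c.K L ∧ (Module.finrank ℚ L = 24 ∨ Module.finrank ℚ L = 48))
    (i : Fin 4)
    (hJS : ∃ S : Finset I,
        (∀ j ∈ S, (line j).scalar = c.D.a i) ∧
        ∀ (Γ : Level V) (hΓ : Γ.BelowConjThree), ∀ ω ∈ R.Theta V c i Γ,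
          ∃ cf : towerLevel hHD hI (ballQuotientUniformisedDatum_of h₁) h₃ hA Γ hΓ,
            TowerLevel.res hHD hI (ballQuotientUniformisedDatum_of h₁) h₃ hA cf = ω ∧
              (ofLevel hHD hI (ballQuotientUniformisedDatum_of h₁) h₃ hA Γ hΓ cf :
                  (liuDictionaryOfWeilFamily hHD hI h₁ h₃ hA V ιV I line GoodCharI).H) ∈
                ⨆ j ∈ S, (liuDictionaryOfWeilFamily hHD hI h₁ h₃ hA V ιV I line GoodCharI).block j) :
    ∃ Γ₀ : Level V, ∀ Γ ≤ Γ₀,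
      ∃ (M : CMField) (k : c.K →+* M) (σ' : M →+* ℂ), σ'.comp k = c.σ ∧
        R.Theta V c i Γ ⊆ (picardCMUniverse hHD hI h₁ h₃).Uiso Γ M (inflate k (c.Ψ i)) σ' :=
  hsmall_of_tower_at_of_scalar hHD hI h₁ h₃ hR hA R V c I (fun j => {χ : (line j).CharW // GoodCharI j χ})
    (fun j a => (line j).Ω ιV a.1) (fun j => (line j).scalar) (fun j => (line j).conj_scalar)
    (fun j => (line j).scalar_ne_zero) hcite hgood hrec h6 i hJS

/-! ## 4. The automorphy pin OF RECORD: `χ₀ := 1` (theta-3-g26 THE WORD, STATUS l.14646)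

[Liu21, Def. 4.11] third bullet, as printed: «an automorphic character `χ = ⊗χ_v : E¹\(𝔸_E^∞)¹ → ℂ^×`» — a character of the
FINITE-adèlic norm-one torus, trivial on the diagonally embedded rational points, with no archimedean component.  On the line `p`
(`U(W) = E¹`): CONTINUITY (`IsLevelTrivial`, the (R2) cut) ∧ RATIONAL TRIVIALITY (`HasRationalRestriction χ 1`).  A definitional
predicate (the `GoodChar` slot's term of record); nothing asserted, nothing cited. -/

namespace SplitLine

variable (p : SplitLine JV TV hcδ hδ hd hV hVd hJV)

/-- **`GoodChar` OF RECORD on the index line `p`**: `χ : U(W)(𝔸_f) →* ℂˣ` is level-trivial (`χ = 1` on some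
`U(W)(𝔸_f) ∩ K_f(M)`) and trivial on the rational points `U(W)(L⁺)` (theta-3-g26: `χ₀ := 1`). [folklore] -/
def IsAutChar (χ : p.CharW) : Prop :=
  p.IsLevelTrivial χ ∧ p.HasRationalRestriction χ 1

/-- (Ported verbatim from the HodgeCMPerL package; no docstring in the source.) -/
theorem isAutChar_iff (χ : p.CharW) :
    p.IsAutChar χ ↔
      IsOpen ((χ.ker : Subgroup _) : Set ↥(UnitaryGroup.finAdelic (↥(maximalRealSubfield (L : Type))) (L : Type)
        (IsCMField.complexConj (L : Type)) 1 p.JW)) ∧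
      ∀ γ, χ (UnitaryGroup.rationalToFinAdelic (↥(maximalRealSubfield (L : Type))) (L : Type)
        (IsCMField.complexConj (L : Type)) 1 p.JW γ) = 1 := by
  simp only [IsAutChar, isLevelTrivial_iff_isOpen_ker, hasRationalRestriction_iff, MonoidHom.one_apply]

/-- (Ported verbatim from the HodgeCMPerL package; no docstring in the source.) -/
theorem isAutChar_one : p.IsAutChar 1 := ⟨p.isLevelTrivial_one, p.hasRationalRestriction_one⟩

/-- automorphic characters of the line are closed under products. -/
theorem IsAutChar.mul {χ χ' : p.CharW} (hχ : p.IsAutChar χ) (hχ' : p.IsAutChar χ') : p.IsAutChar (χ * χ') := by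
  refine ⟨IsLevelTrivial.mul p hχ.1 hχ'.1, ?_⟩
  have e : χ.comp (UnitaryGroup.rationalToFinAdelic (↥(maximalRealSubfield (L : Type))) (L : Type)
      (IsCMField.complexConj (L : Type)) 1 p.JW) = 1 := hχ.2
  have e' : χ'.comp (UnitaryGroup.rationalToFinAdelic (↥(maximalRealSubfield (L : Type))) (L : Type)
      (IsCMField.complexConj (L : Type)) 1 p.JW) = 1 := hχ'.2
  show (χ * χ').comp _ = 1
  rw [MonoidHom.mul_comp, e, e', mul_one]

/-- automorphic characters of the line are closed under inverses. -/
theorem IsAutChar.inv {χ : p.CharW} (hχ : p.IsAutChar χ) : p.IsAutChar χ⁻¹ := by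
  refine ⟨IsLevelTrivial.inv p hχ.1, ?_⟩
  have e : χ.comp (UnitaryGroup.rationalToFinAdelic (↥(maximalRealSubfield (L : Type))) (L : Type)
      (IsCMField.complexConj (L : Type)) 1 p.JW) = 1 := hχ.2
  show χ⁻¹.comp _ = 1
  rw [MonoidHom.inv_comp, e, inv_one]

end SplitLine

/-- **THE INDEXED DICTIONARY WITH THE `GoodChar` OF RECORD** (`GoodChar i χ := (line i).IsAutChar χ`): the only parameters left
are the theta lane's index type `I` and its line map. -/
abbrev liuDictionaryOfWeilFamilyAut : LiuDictionary hHD hI h₁ h₃ V :=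
  liuDictionaryOfWeilFamily hHD hI h₁ h₃ hA V ιV I line fun i χ => (line i).IsAutChar χ

/-- (Ported verbatim from the HodgeCMPerL package; no docstring in the source.) -/
theorem liuDictionaryOfWeilFamilyAut_eq :
    liuDictionaryOfWeilFamilyAut hHD hI h₁ h₃ hA V ιV I line =
      liuDictionaryOfWeilFamily hHD hI h₁ h₃ hA V ιV I line fun i χ => (line i).IsAutChar χ := rfl

/-- **E's `hsmall` OVER THE INDEXED INSTANCE WITH THE `GoodChar` OF RECORD, POINTWISE** (§3 at `GoodChar := IsAutChar`). -/
theorem hsmall_of_weilFamilyAut_at (hR : DeligneMilne1982_Thm_6_20_full)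
    (R : (picardCMUniverse hHD hI h₁ h₃).ThetaModel) (c : SeesawCtx L)
    (hcite : (liuDictionaryOfWeilFamilyAut hHD hI h₁ h₃ hA V ιV I line).Irreducible ∧
      (liuDictionaryOfWeilFamilyAut hHD hI h₁ h₃ hA V ιV I line).Prop413 ∧
      (liuDictionaryOfWeilFamilyAut hHD hI h₁ h₃ hA V ιV I line).Thm418_2 ∧
      (liuDictionaryOfWeilFamilyAut hHD hI h₁ h₃ hA V ιV I line).MuSeparated ∧
      (liuDictionaryOfWeilFamilyAut hHD hI h₁ h₃ hA V ιV I line).Thm418C)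
    (hgood : R.GoodCtx ι₁ c) (hrec : SignRecipe.GoodCtx (Model.orientBitι L ι₁) ι₁ c)
    (h6 : Module.finrank ℚ c.K = 6 ∧ IsNormalClosure ℚ c.K L ∧ (Module.finrank ℚ L = 24 ∨ Module.finrank ℚ L = 48))
    (i : Fin 4)
    (hJS : ∃ S : Finset I,
        (∀ j ∈ S, (line j).scalar = c.D.a i) ∧
        ∀ (Γ : Level V) (hΓ : Γ.BelowConjThree), ∀ ω ∈ R.Theta V c i Γ,
          ∃ cf : towerLevel hHD hI (ballQuotientUniformisedDatum_of h₁) h₃ hA Γ hΓ,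
            TowerLevel.res hHD hI (ballQuotientUniformisedDatum_of h₁) h₃ hA cf = ω ∧
              (ofLevel hHD hI (ballQuotientUniformisedDatum_of h₁) h₃ hA Γ hΓ cf :
                  (liuDictionaryOfWeilFamilyAut hHD hI h₁ h₃ hA V ιV I line).H) ∈
                ⨆ j ∈ S, (liuDictionaryOfWeilFamilyAut hHD hI h₁ h₃ hA V ιV I line).block j) :
    ∃ Γ₀ : Level V, ∀ Γ ≤ Γ₀,
      ∃ (M : CMField) (k : c.K →+* M) (σ' : M →+* ℂ), σ'.comp k = c.σ ∧
        R.Theta V c i Γ ⊆ (picardCMUniverse hHD hI h₁ h₃).Uiso Γ M (inflate k (c.Ψ i)) σ' :=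
  hsmall_of_weilFamily_at hHD hI h₁ h₃ hA V ιV I line (fun i χ => (line i).IsAutChar χ) hR R c hcite hgood hrec h6 i hJS

end HodgeCM.Model

end
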